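import Mathlib
import HarnessLib

/-!
# K2 ∕ E3 «EllipticInputs», unit U12 «HC characters» — GENERIC ENGINE of socket U12-b `sig_K2E3OrbitClosureContainsSemisimple` (row 10):
# `K2E3OrbitClosureSemisimpleEngine` — **over a topological field with an element `u ≠ 0`, `uᵏ → 0`, the conjugates of `x = s + N` (`s` semisimple, `N` nilpotent,
# `sN = Ns`) by a cocharacter of `GL_n` adapted to the kernel flag of `N` converge to `s`; hence `s` lies in the closure of the conjugacy class of `x`**

Cell `hodgecm-mathlib` (Track B «K2-LIT»), engine E3, crux H413 = `stmt-HodgeConjecture-24833`, route of record `route-HodgeConjecture-HCCMUnconditional`; tier-1 socket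
module `Cruxes/H413/Lines/K2_E3_EllipticInputsSigs_U12Characters.lean` :131 `U12Characters.sig_K2E3OrbitClosureContainsSemisimple` (HC1999 §21: «the closure of a `G`-orbit
contains a semisimple element»); DEALT by K2E3-plan (g1) ONE-WORD RULINGS 2026-09-03T23:09:36Z (c) to the free E5 hand K2E5-p11 (g2) as FILE 1 = the GENERIC (general linear)
engine; FILE 2 (the unitary descent: a cocharacter inside `U_N(H)(L⁺_v)`, i.e. a self-dual adapted splitting) is a separate file and NOT claimed here.  PROOF lane, THEOREMS ONLY
(no `def`, no `instance`, no `notation`, no named-fact hypothesis, no `sorry`); Mathlib-only; `--supports stmt-HodgeConjecture-24833 --as helper` (count-neutral).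

THE MATHEMATICS ([HarishChandra1999, §21 p. 87], [Borel1991, §4.4 Thm., §11.8], [SpringerLAG1998, 2.4.8 (ii) with 6.4.5]).  `F` a field with a ring topology, `u ∈ Fˣ`
with `uᵏ → 0` (any non-archimedean local field: a uniformiser), `V = Fⁿ`, `x = s + N ∈ M_n(F)`, `s` SEMISIMPLE (Mathlib `Module.End.IsSemisimple (Matrix.toLin' s)`: every
`s`-stable subspace has an `s`-stable complement), `N` NILPOTENT, `sN = Ns` (additive Jordan form; the multiplicative form `x = s·v`, `v` unipotent, is the case `N = s(v − 1)`).
* §1 GRADED MATRICES (any commutative topological ring `R`, `u ∈ Rˣ`, `uᵏ → 0`): for a weight `w : ι → ℕ`, if `S` is `w`-block-diagonal (`S_{ab} = 0` unless `w a = w b`) and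
  `M` is `w`-RAISING (`M_{ab} = 0` unless `w b < w a`), then `diag(u^{k·w}) · (S + M) · diag(u^{−k·w}) = S + (u^{k(w a − w b)} M_{ab})_{ab} → S` (`tendsto_diagonal_pow_conj`).
* §2 ADAPTED BASES (linear algebra over a field): for commuting endomorphisms `f` semisimple and `g` with `g^m = 0` of a finite-dimensional `V` there is a basis `b` and a
  weight `w` with `[f]_b` `w`-block-diagonal and `[g]_b` `w`-raising — induction on `m` along the `f`-stable flag `ker g^m ⊂ V`: an `f`-STABLE complement `W` of
  `K = ker g^m` exists by semisimplicity, `g(V) ⊆ K`, and `(K, f|_K, g|_K)` is the case `m` (`exists_basis_blockDiagonal_raising`).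
* §3 COCHARACTER + CLOSURE: transporting §2 to matrices (change of basis `P`, `Q = P⁻¹`), `Λ(t) := P·diag(t^w)·Q` is a monoid hom `Fˣ →* GL_n(F)` with `Λ(t) s Λ(t)⁻¹ = s`
  and `Λ(uᵏ) x Λ(uᵏ)⁻¹ → s` (`exists_cocharacter_conj_tendsto`); hence `s ∈ closure {γ x γ⁻¹ : γ ∈ Γ}` for every subgroup `Γ ≤ GL_n(F)` containing the `Λ(uᵏ)` — in
  particular for `Γ = GL_n(F)` (`semisimplePart_mem_closure_conjClass`, multiplicative form `…_mul`).
HONEST LABEL: HC_CM is proved only modulo the 7 printed citations (2 remaining named inputs: hLiu418 = stmt-HodgeConjecture-24832, h413 = stmt-HodgeConjecture-24833) until rung 0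
closes; this helper pays no socket by itself (U12-b needs FILE 2, the unitary descent).

## References
* [HarishChandra1999] Harish-Chandra (notes by S. DeBacker, P. J. Sally), *Admissible Invariant Distributions on Reductive p-adic Groups*, ULS 16 (1999), §21 p. 87.
* [Borel1991] A. Borel, *Linear Algebraic Groups*, 2nd ed., GTM 126 (1991), §4.4 (Jordan decomposition), §11.8.
* [SpringerLAG1998] T. A. Springer, *Linear Algebraic Groups*, 2nd ed. (1998), 2.4.8, 6.4.5.
-/

set_option autoImplicit false
-- the mandated namespace repeats the single-problem summit's segment (`HodgeConjecture.HodgeConjecture`)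
set_option linter.dupNamespace false

noncomputable section

namespace Summit.HodgeConjecture.HodgeConjecture.Cruxes.H413.K2E3OrbitClosureSemisimpleEngine

open Filter Topology Matrix

universe u v

/-! ## §1 Graded matrices over a commutative topological ring -/

section Graded

variable {R : Type*} [CommRing R] {ι : Type*} [Fintype ι] [DecidableEq ι]

/-- Entry formula `(diag d · X · diag d′)_{ab} = d_a X_{ab} d′_b`. [folklore] -/
theorem diagonal_mul_mul_diagonal_apply (d d' : ι → R) (X : Matrix ι ι R) (a b : ι) :
    (diagonal d * X * diagonal d') a b = d a * X a b * d' b := by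
  rw [mul_diagonal, diagonal_mul]

/-- **Block-diagonal part is fixed**: if `S_{ab} = 0` unless `w a = w b`, then `diag(t^w) · S · diag(t′^w) = S` whenever `t t′ = 1`. [cite: Borel1991, §4.4] -/
theorem diagonal_pow_conj_of_blockDiagonal {t t' : R} (htt' : t * t' = 1) (w : ι → ℕ) {S : Matrix ι ι R} (hS : ∀ a b, w a ≠ w b → S a b = 0) :
    diagonal (fun a => t ^ w a) * S * diagonal (fun a => t' ^ w a) = S := by
  ext a b
  rw [diagonal_mul_mul_diagonal_apply]
  by_cases h : w a = w b
  · rw [h, mul_assoc, mul_comm (S a b), ← mul_assoc, ← mul_pow, htt', one_pow, one_mul]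
  · rw [hS a b h, mul_zero, zero_mul]

/-- **Raising part is scaled**: if `M_{ab} = 0` unless `w b < w a`, then `(diag(t^w) · M · diag(t′^w))_{ab} = t^{w a − w b} M_{ab}` whenever `t t′ = 1`. [cite: Borel1991, §4.4] -/
theorem diagonal_pow_conj_apply_of_raising {t t' : R} (htt' : t * t' = 1) (w : ι → ℕ) {M : Matrix ι ι R} (hM : ∀ a b, w a ≤ w b → M a b = 0) (a b : ι) :
    (diagonal (fun a => t ^ w a) * M * diagonal (fun a => t' ^ w a)) a b = t ^ (w a - w b) * M a b := by
  rw [diagonal_mul_mul_diagonal_apply]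
  by_cases h : w a ≤ w b
  · rw [hM a b h, mul_zero, zero_mul, mul_zero]
  · have e : w a = (w a - w b) + w b := (Nat.sub_add_cancel (le_of_lt (not_le.1 h))).symm
    conv_lhs => rw [e]
    rw [pow_add, mul_assoc, mul_assoc, mul_comm (M a b), ← mul_assoc (t ^ w b), ← mul_pow, htt', one_pow, one_mul]

variable [TopologicalSpace R] [IsTopologicalRing R]

/-- **GRADED CONVERGENCE**: for `u ∈ Rˣ` with `uᵏ → 0`, a weight `w`, `S` `w`-block-diagonal and `M` `w`-raising,
`diag(u^{k·w}) · (S + M) · diag(u^{−k·w}) → S` as `k → ∞` (entry `(a, b)` of the error is `(u^{w a − w b})ᵏ M_{ab}` with `w a − w b ≥ 1`).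
[cite: Borel1991, §4.4] [cite: SpringerLAG1998, 2.4.8] -/
theorem tendsto_diagonal_pow_conj (u : Rˣ) (hu : Tendsto (fun k : ℕ => (u : R) ^ k) atTop (𝓝 0)) (w : ι → ℕ) {S M : Matrix ι ι R}
    (hS : ∀ a b, w a ≠ w b → S a b = 0) (hM : ∀ a b, w a ≤ w b → M a b = 0) :
    Tendsto (fun k : ℕ => diagonal (fun a => ((u : R) ^ k) ^ w a) * (S + M) * diagonal (fun a => ((↑u⁻¹ : R) ^ k) ^ w a)) atTop (𝓝 S) := by
  have htt : ∀ k : ℕ, ((u : R) ^ k) * ((↑u⁻¹ : R) ^ k) = 1 := fun k => by rw [← mul_pow, Units.mul_inv, one_pow]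
  have hE : Tendsto (fun k : ℕ => diagonal (fun a => ((u : R) ^ k) ^ w a) * M * diagonal (fun a => ((↑u⁻¹ : R) ^ k) ^ w a)) atTop (𝓝 0) := by
    refine tendsto_pi_nhds.2 fun a => tendsto_pi_nhds.2 fun b => ?_
    have e : (fun k : ℕ => (diagonal (fun a => ((u : R) ^ k) ^ w a) * M * diagonal (fun a => ((↑u⁻¹ : R) ^ k) ^ w a)) a b) =
        fun k : ℕ => (((u : R) ^ (w a - w b)) ^ k) * M a b := by
      funext k
      rw [diagonal_pow_conj_apply_of_raising (htt k) w hM, ← pow_mul, mul_comm k, pow_mul]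
    rw [e, Matrix.zero_apply]
    by_cases h : w a ≤ w b
    · simp only [hM a b h, mul_zero]
      exact tendsto_const_nhds
    · have hd : w a - w b ≠ 0 := Nat.sub_ne_zero_of_lt (not_le.1 h)
      have h1 : Tendsto (fun k : ℕ => ((u : R) ^ (w a - w b)) ^ k) atTop (𝓝 0) := by
        have h2 := hu.pow (w a - w b)
        rw [zero_pow hd] at h2
        refine h2.congr fun k => ?_
        rw [← pow_mul, ← pow_mul, mul_comm]
      simpa using h1.mul_const (M a b)
  have e : (fun k : ℕ => diagonal (fun a => ((u : R) ^ k) ^ w a) * (S + M) * diagonal (fun a => ((↑u⁻¹ : R) ^ k) ^ w a)) =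
      fun k : ℕ => S + diagonal (fun a => ((u : R) ^ k) ^ w a) * M * diagonal (fun a => ((↑u⁻¹ : R) ^ k) ^ w a) := by
    funext k
    rw [Matrix.mul_add, Matrix.add_mul, diagonal_pow_conj_of_blockDiagonal (htt k) w hS]
  rw [e]
  simpa using tendsto_const_nhds.add hE

end Graded

/-! ## §2 Adapted bases: `f` semisimple, `g` nilpotent, `fg = gf` -/

section Adapted

variable (F : Type u) [Field F]

/-- **ADAPTED BASIS** (induction on the nilpotency bound `m`): for commuting endomorphisms `f`, `g` of a finite-dimensional `F`-space with `f` semisimple and `g^m = 0`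
there are a finite basis `b` and a weight `w` such that `[f]_b` is `w`-block-diagonal (`b.repr (f (b j)) i = 0` unless `w i = w j`) and `[g]_b` is `w`-RAISING
(`b.repr (g (b j)) i = 0` unless `w j < w i`).  Step: `K = ker g^m` is `f`- and `g`-stable, has an `f`-stable complement `W` (semisimplicity), `g(V) ⊆ K`; weights
`w|_K + 1` on an adapted basis of `K` (induction) and `0` on any basis of `W`. [cite: Borel1991, §4.4] [cite: SpringerLAG1998, 2.4.8] -/
theorem exists_basis_blockDiagonal_raising :
    ∀ (m : ℕ) (V : Type v) [AddCommGroup V] [Module F V] [FiniteDimensional F V] (f g : Module.End F V),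
      f.IsSemisimple → g ^ m = 0 → f * g = g * f →
      ∃ (ι : Type) (_ : Fintype ι) (b : Module.Basis ι F V) (w : ι → ℕ),
        (∀ i j, w i ≠ w j → b.repr (f (b j)) i = 0) ∧ (∀ i j, w i ≤ w j → b.repr (g (b j)) i = 0) := by
  intro m
  induction m with
  | zero =>
    intro V _ _ _ f g _ hg _
    haveI : Subsingleton V := ⟨fun a b => by
      have ha : (1 : Module.End F V) a = (1 : Module.End F V) b := by rw [← pow_zero g, hg, LinearMap.zero_apply, LinearMap.zero_apply]
      simpa using ha⟩
    exact ⟨PEmpty, inferInstance, Module.Basis.empty V, fun i => i.elim, fun i => i.elim, fun i => i.elim⟩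
  | succ m ih =>
    intro V _ _ _ f g hf hg hc
    -- the `f`- and `g`-stable subspace `K = ker g^m`
    set K : Submodule F V := LinearMap.ker (g ^ m) with hK
    have hcomm : Commute f g := hc
    have hKf : K ∈ f.invtSubmodule := fun x hx => by
      rw [Submodule.mem_comap, hK, LinearMap.mem_ker, ← Module.End.mul_apply, ← (hcomm.pow_right m).eq, Module.End.mul_apply,
        (LinearMap.mem_ker.1 hx), map_zero]
    have hKg : K ∈ g.invtSubmodule := fun x hx => by
      rw [Submodule.mem_comap, hK, LinearMap.mem_ker, ← Module.End.mul_apply, ← ((Commute.refl g).pow_right m).eq, Module.End.mul_apply,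
        (LinearMap.mem_ker.1 hx), map_zero]
    have hgV : ∀ x : V, g x ∈ K := fun x => by
      rw [hK, LinearMap.mem_ker, ← Module.End.mul_apply, ← pow_succ, hg, LinearMap.zero_apply]
    -- an `f`-stable complement `W`
    obtain ⟨W, hWf, hKW⟩ := (Module.End.isSemisimple_iff.1 hf) K hKf
    -- restrictions to `K`
    set fK : Module.End F K := f.restrict hKf with hfK
    set gK : Module.End F K := g.restrict hKg with hgK
    have hfKss : fK.IsSemisimple := hf.restrict hKf
    have hgKm : gK ^ m = 0 := by
      rw [hgK, Module.End.pow_restrict]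
      ext x
      simp only [LinearMap.restrict_apply, LinearMap.zero_apply, ZeroMemClass.coe_zero]
      exact LinearMap.mem_ker.1 x.2
    have hcK : fK * gK = gK * fK := LinearMap.ext fun x => Subtype.ext (LinearMap.congr_fun hc x.1)
    obtain ⟨ιK, instK, bK, wK, h1, h2⟩ := ih K fK gK hfKss hgKm hcK
    -- the combined basis `b = (bK ⊔ bW)` transported along `K × W ≃ V`
    set bW := Module.finBasis F W with hbW
    set e := Submodule.prodEquivOfIsCompl K W hKW with he
    set b : Module.Basis (ιK ⊕ Fin (Module.finrank F W)) F V := (bK.prod bW).map e with hb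
    have hreprK : ∀ (x : K) (i : ιK ⊕ Fin (Module.finrank F W)), b.repr (x : V) i = Sum.elim (fun i => bK.repr x i) (fun _ => 0) i := by
      intro x i
      rw [hb, Module.Basis.map_repr, LinearEquiv.trans_apply, he, Submodule.prodEquivOfIsCompl_symm_apply_left]
      rcases i with i | i
      · rw [Module.Basis.prod_repr_inl, Sum.elim_inl]
      · rw [Module.Basis.prod_repr_inr, map_zero, Finsupp.zero_apply, Sum.elim_inr]
    have hreprW : ∀ (y : W) (i : ιK ⊕ Fin (Module.finrank F W)), b.repr (y : V) i = Sum.elim (fun _ => 0) (fun i => bW.repr y i) i := by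
      intro y i
      rw [hb, Module.Basis.map_repr, LinearEquiv.trans_apply, he, Submodule.prodEquivOfIsCompl_symm_apply_right]
      rcases i with i | i
      · rw [Module.Basis.prod_repr_inl, map_zero, Finsupp.zero_apply, Sum.elim_inl]
      · rw [Module.Basis.prod_repr_inr, Sum.elim_inr]
    have hbinl : ∀ j, b (Sum.inl j) = (bK j : V) := fun j => by
      rw [hb, Module.Basis.map_apply, Module.Basis.prod_apply, Sum.elim_inl, Function.comp_apply, LinearMap.inl_apply, he,
        Submodule.coe_prodEquivOfIsCompl', Submodule.coe_zero, add_zero]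
    have hbinr : ∀ j, b (Sum.inr j) = (bW j : V) := fun j => by
      rw [hb, Module.Basis.map_apply, Module.Basis.prod_apply, Sum.elim_inr, Function.comp_apply, LinearMap.inr_apply, he,
        Submodule.coe_prodEquivOfIsCompl', Submodule.coe_zero, zero_add]
    -- images of basis vectors as elements of `K` ∕ `W`
    have hfK_coe : ∀ j, f (bK j : V) = ((fK (bK j) : K) : V) := fun j => rfl
    have hgK_coe : ∀ j, g (bK j : V) = ((gK (bK j) : K) : V) := fun j => rfl
    have hfW_coe : ∀ j, f (bW j : V) = ((⟨f (bW j : V), hWf (bW j).2⟩ : W) : V) := fun j => rfl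
    have hgW_coe : ∀ j, g (bW j : V) = ((⟨g (bW j : V), hgV (bW j : V)⟩ : K) : V) := fun j => rfl
    refine ⟨ιK ⊕ Fin (Module.finrank F W), inferInstance, b, Sum.elim (fun i => wK i + 1) (fun _ => 0), ?_, ?_⟩
    · -- `[f]_b` is block-diagonal
      rintro (i | i) (j | j) hw
      · rw [hbinl, hfK_coe, hreprK, Sum.elim_inl]
        exact h1 i j fun h => hw (by rw [Sum.elim_inl, Sum.elim_inl, h])
      · rw [hbinr, hfW_coe, hreprW, Sum.elim_inl]
      · rw [hbinl, hfK_coe, hreprK, Sum.elim_inr]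
      · exact absurd rfl hw
    · -- `[g]_b` is raising
      rintro (i | i) (j | j) hw
      · rw [hbinl, hgK_coe, hreprK, Sum.elim_inl]
        exact h2 i j (by simpa using hw)
      · exact absurd hw (by simp)
      · rw [hbinl, hgK_coe, hreprK, Sum.elim_inr]
      · rw [hbinr, hgW_coe, hreprK, Sum.elim_inr]

end Adapted

/-! ## §3 Matrices: adapted change of basis, the cocharacter, convergence and the closure of the conjugacy class -/

section Matrices

variable {F : Type u} [Field F] {n : Type*} [Fintype n] [DecidableEq n]

/-- `toLin'` is multiplicative on powers. [folklore] -/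
theorem toLin'_pow (N : Matrix n n F) (m : ℕ) : Matrix.toLin' (N ^ m) = Matrix.toLin' N ^ m := by
  induction m with
  | zero => rw [pow_zero, pow_zero, Matrix.toLin'_one]; rfl
  | succ m ih => rw [pow_succ, Matrix.toLin'_mul, ih, pow_succ]; rfl

/-- **ADAPTED CHANGE OF BASIS FOR MATRICES**: for `s` semisimple, `N` nilpotent with `sN = Ns` there are mutually inverse `P`, `Q` and a weight `w : n → ℕ` with `Q s P`
`w`-block-diagonal and `Q N P` `w`-raising (§2 transported along `LinearMap.toMatrix`, basis re-indexed by `n`). [cite: Borel1991, §4.4] [cite: SpringerLAG1998, 2.4.8] -/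
theorem exists_conj_blockDiagonal_raising {s N : Matrix n n F} (hs : Module.End.IsSemisimple (Matrix.toLin' s)) (hN : IsNilpotent N) (hc : s * N = N * s) :
    ∃ (P Q : Matrix n n F) (w : n → ℕ), Q * P = 1 ∧ P * Q = 1 ∧
      (∀ a b, w a ≠ w b → (Q * s * P) a b = 0) ∧ (∀ a b, w a ≤ w b → (Q * N * P) a b = 0) := by
  obtain ⟨m, hm⟩ := hN
  have hg : Matrix.toLin' N ^ m = 0 := by rw [← toLin'_pow, hm, map_zero]
  have hcomm : Matrix.toLin' s * Matrix.toLin' N = Matrix.toLin' N * Matrix.toLin' s := by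
    rw [Module.End.mul_eq_comp, Module.End.mul_eq_comp, ← Matrix.toLin'_mul, ← Matrix.toLin'_mul, hc]
  obtain ⟨ι, _, b₀, w₀, h1, h2⟩ := exists_basis_blockDiagonal_raising F m (n → F) (Matrix.toLin' s) (Matrix.toLin' N) hs hg hcomm
  -- re-index by `n`
  set ε : ι ≃ n := b₀.indexEquiv (Pi.basisFun F n) with hε
  set b : Module.Basis n F (n → F) := b₀.reindex ε with hb
  refine ⟨(Pi.basisFun F n).toMatrix b, b.toMatrix (Pi.basisFun F n), fun a => w₀ (ε.symm a), Module.Basis.toMatrix_mul_toMatrix_flip _ _,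
    Module.Basis.toMatrix_mul_toMatrix_flip _ _, ?_, ?_⟩
  · intro a c hw
    rw [← LinearMap.toMatrix'_toLin' s, ← LinearMap.toMatrix_eq_toMatrix', basis_toMatrix_mul_linearMap_toMatrix_mul_basis_toMatrix, LinearMap.toMatrix_apply,
      hb, Module.Basis.repr_reindex_apply, Module.Basis.reindex_apply]
    exact h1 _ _ hw
  · intro a c hw
    rw [← LinearMap.toMatrix'_toLin' N, ← LinearMap.toMatrix_eq_toMatrix', basis_toMatrix_mul_linearMap_toMatrix_mul_basis_toMatrix, LinearMap.toMatrix_apply,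
      hb, Module.Basis.repr_reindex_apply, Module.Basis.reindex_apply]
    exact h2 _ _ hw

variable [TopologicalSpace F] [IsTopologicalRing F]

/-- **THE COCHARACTER**: for `s` semisimple, `N` nilpotent, `sN = Ns` in `M_n(F)` and `u ∈ Fˣ` with `uᵏ → 0` there is a monoid hom `Λ : Fˣ →* GL_n(F)` (`t ↦ P·diag(t^w)·P⁻¹`
for an adapted basis) with `Λ(t) s Λ(t)⁻¹ = s` for all `t` and `Λ(uᵏ) (s + N) Λ(uᵏ)⁻¹ → s`. [cite: HarishChandra1999, §21 p. 87] [cite: Borel1991, §4.4, §11.8] -/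
theorem exists_cocharacter_conj_tendsto (u : Fˣ) (hu : Tendsto (fun k : ℕ => (u : F) ^ k) atTop (𝓝 0)) {s N : Matrix n n F}
    (hs : Module.End.IsSemisimple (Matrix.toLin' s)) (hN : IsNilpotent N) (hc : s * N = N * s) :
    ∃ Λ : Fˣ →* GL n F, (∀ t, (Λ t : Matrix n n F) * s * (((Λ t)⁻¹ : GL n F) : Matrix n n F) = s) ∧
      Tendsto (fun k : ℕ => (Λ (u ^ k) : Matrix n n F) * (s + N) * (((Λ (u ^ k))⁻¹ : GL n F) : Matrix n n F)) atTop (𝓝 s) := by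
  obtain ⟨P, Q, w, hQP, hPQ, hS, hM⟩ := exists_conj_blockDiagonal_raising hs hN hc
  -- the diagonal cocharacter in the adapted frame, as units
  have hdd : ∀ t t' : F, t * t' = 1 → diagonal (fun a => t ^ w a) * diagonal (fun a => t' ^ w a) = 1 := fun t t' h => by
    rw [diagonal_mul_diagonal, ← diagonal_one]
    congr 1
    funext a
    rw [← mul_pow, h, one_pow]
  have hPXQ : ∀ X Y : Matrix n n F, (P * X * Q) * (P * Y * Q) = P * (X * Y) * Q := fun X Y => by
    simp only [Matrix.mul_assoc]
    rw [← Matrix.mul_assoc Q P, hQP, Matrix.one_mul]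
  let Λ : Fˣ →* GL n F :=
    { toFun := fun t => ⟨P * diagonal (fun a => (t : F) ^ w a) * Q, P * diagonal (fun a => ((t⁻¹ : Fˣ) : F) ^ w a) * Q,
        by rw [hPXQ, hdd _ _ (by rw [Units.mul_inv]), Matrix.mul_one, hPQ], by rw [hPXQ, hdd _ _ (by rw [Units.inv_mul]), Matrix.mul_one, hPQ]⟩
      map_one' := Units.ext (by simp only [Units.val_one, one_pow, diagonal_one, Matrix.mul_one, hPQ])
      map_mul' := fun t t' => Units.ext (by
        simp only [Units.val_mul, hPXQ, diagonal_mul_diagonal, mul_pow]) }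
  have hΛ : ∀ t : Fˣ, (Λ t : Matrix n n F) = P * diagonal (fun a => (t : F) ^ w a) * Q := fun t => rfl
  have hΛinv : ∀ t : Fˣ, ((Λ t)⁻¹ : GL n F) = Λ t⁻¹ := fun t => (map_inv Λ t).symm
  have hconj : ∀ (t : Fˣ) (X : Matrix n n F), (Λ t : Matrix n n F) * X * (((Λ t)⁻¹ : GL n F) : Matrix n n F) =
      P * (diagonal (fun a => (t : F) ^ w a) * (Q * X * P) * diagonal (fun a => ((t⁻¹ : Fˣ) : F) ^ w a)) * Q := fun t X => by
    rw [hΛinv, hΛ, hΛ]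
    simp only [Matrix.mul_assoc]
  have hPQX : ∀ X : Matrix n n F, P * (Q * X * P) * Q = X := fun X => by
    rw [Matrix.mul_assoc Q X P, ← Matrix.mul_assoc P Q, hPQ, Matrix.one_mul, Matrix.mul_assoc, hPQ, Matrix.mul_one]
  refine ⟨Λ, fun t => ?_, ?_⟩
  · rw [hconj, diagonal_pow_conj_of_blockDiagonal (Units.mul_inv t) w hS, hPQX]
  · have h : Tendsto (fun k : ℕ => P * (diagonal (fun a => ((u : F) ^ k) ^ w a) * (Q * s * P + Q * N * P) * diagonal (fun a => ((↑u⁻¹ : F) ^ k) ^ w a)) * Q)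
        atTop (𝓝 (P * (Q * s * P) * Q)) :=
      (tendsto_const_nhds.mul (tendsto_diagonal_pow_conj u hu w hS hM)).mul tendsto_const_nhds
    rw [hPQX] at h
    refine h.congr fun k => ?_
    rw [hconj, ← inv_pow, Units.val_pow_eq_pow_val, Units.val_pow_eq_pow_val]
    simp only [Matrix.mul_add, Matrix.add_mul]

omit [IsTopologicalRing F] in
/-- **`s` LIES IN THE CLOSURE OF THE `Γ`-CONJUGACY CLASS OF `x = s + N`** for every subgroup `Γ ≤ GL_n(F)` containing the values `Λ(uᵏ)` of the cocharacter — the form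
FILE 2 (unitary descent) consumes once a cocharacter inside `U_N(H)` is produced. [cite: HarishChandra1999, §21 p. 87] -/
theorem mem_closure_conj_of_tendsto {Γ : Subgroup (GL n F)} {x s : Matrix n n F} {γ : ℕ → GL n F} (hγ : ∀ k, γ k ∈ Γ)
    (h : Tendsto (fun k : ℕ => (γ k : Matrix n n F) * x * (((γ k)⁻¹ : GL n F) : Matrix n n F)) atTop (𝓝 s)) :
    s ∈ closure (Set.range fun g : Γ => ((g : GL n F) : Matrix n n F) * x * (((g : GL n F)⁻¹ : GL n F) : Matrix n n F)) :=
  mem_closure_of_tendsto h (Eventually.of_forall fun k => ⟨⟨γ k, hγ k⟩, rfl⟩)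

/-- **HC1999 §21 FOR `GL_n` OVER A TOPOLOGICAL FIELD (additive Jordan form)**: if `s` is semisimple, `N` nilpotent, `sN = Ns`, and `F` has an element `u ≠ 0` with `uᵏ → 0`,
then `s` lies in the closure of the `GL_n(F)`-conjugacy class of `x = s + N`. [cite: HarishChandra1999, §21 p. 87] [cite: Borel1991, §11.8] -/
theorem semisimplePart_mem_closure_conjClass (u : Fˣ) (hu : Tendsto (fun k : ℕ => (u : F) ^ k) atTop (𝓝 0)) {s N : Matrix n n F}
    (hs : Module.End.IsSemisimple (Matrix.toLin' s)) (hN : IsNilpotent N) (hc : s * N = N * s) :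
    s ∈ closure (Set.range fun g : GL n F => (g : Matrix n n F) * (s + N) * ((g⁻¹ : GL n F) : Matrix n n F)) := by
  obtain ⟨Λ, -, hT⟩ := exists_cocharacter_conj_tendsto u hu hs hN hc
  exact mem_closure_of_tendsto hT (Eventually.of_forall fun k => ⟨Λ (u ^ k), rfl⟩)

/-- **HC1999 §21 FOR `GL_n`, multiplicative Jordan form**: if `s` is semisimple, `v` unipotent (`v − 1` nilpotent), `sv = vs`, then `s` lies in the closure of the
`GL_n(F)`-conjugacy class of `x = s·v` (`s·v = s + s(v − 1)` with `s(v − 1)` nilpotent and commuting with `s`). [cite: HarishChandra1999, §21 p. 87] [cite: Borel1991, §4.4] -/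
theorem semisimplePart_mem_closure_conjClass_mul (u : Fˣ) (hu : Tendsto (fun k : ℕ => (u : F) ^ k) atTop (𝓝 0)) {s v : Matrix n n F}
    (hs : Module.End.IsSemisimple (Matrix.toLin' s)) (hv : IsNilpotent (v - 1)) (hc : s * v = v * s) :
    s ∈ closure (Set.range fun g : GL n F => (g : Matrix n n F) * (s * v) * ((g⁻¹ : GL n F) : Matrix n n F)) := by
  have hcv : Commute s v := hc
  have hcomm : Commute s (v - 1) := hcv.sub_right (Commute.one_right s)
  have e : s * v = s + s * (v - 1) := by rw [Matrix.mul_sub, Matrix.mul_one, add_sub_cancel]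
  rw [e]
  exact semisimplePart_mem_closure_conjClass u hu hs (hcomm.isNilpotent_mul_left hv) (by rw [Matrix.mul_assoc, ← hcomm.eq])

end Matrices

end Summit.HodgeConjecture.HodgeConjecture.Cruxes.H413.K2E3OrbitClosureSemisimpleEngine

end
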